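import Summits.QuantumFields.YangMills.Theses.RecentredCoverTransfer
import Summits.QuantumFields.YangMills.Theorems.RecentredCoverTransferMeanShiftTwoPoint
import HarnessLib

/-!
# Route `RecentredCoverTransfer` (LINE g9-B′ of planner ym-idea-1 g9), glue item `CommonCentredOfProductLaw` (stmt-QuantumFields-23258)

`ProductBoundaryLaw → PointwiseTransferOfProductLaw → NearDiagonalVanishing → CommonCentredCoverTransfer`.

Fix the binders of `CommonCentredCoverTransfer` (`n ≥ 2`, `F` off-diagonal with compact support, `tsupport F ⊆ closedBall 0 K_F`) and
write `W^C_k(x)`, `W^T_k(x)` for the centred `n`-point moments of the action density on the checkerboard cell `C_k` (through `lift`)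
and on the straight torus (through `torusLift`), both centred at the torus mean `m_T(k)`.

1. **Identification** (`PeriodCell.dist_apply`, `latticeDist_apply`): both distributions are finite sums `Σ_x W_k(x)·F(a_k x)`, over
   `repsⁿ` resp. `box(L_k)ⁿ`; representatives outside `box(L_k)` carry `F(a_k x) = 0` once `K_F < a_k(L_k+1)` (compact support,
   `a_k L_k → ∞`), so the difference is `D_k = Σ_{x ∈ box(L_k)ⁿ} (W^C_k − W^T_k)(x)·F(a_k x)` eventually.
2. **Pointwise split** (`abs_sub_mul_le_near_add_far`): for every `x`,
   `|W^C − W^T|·‖F‖ ≤ 1_near·|W^C|·‖F‖ + 1_near·|W^T|·‖F‖ + ε′a_k^{4n}·‖F(a_k x)‖`, because a FAR tuple (all pairs at physical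
   sup-distance `≥ δ`) inside the physical ball `K_F` has `|W^C − W^T| ≤ ε′a_k^{4n}` by the pointwise moment transfer
   (`PointwiseTransferOfProductLaw` applied to `ProductBoundaryLaw`), and outside that ball `F(a_k x) = 0`.
3. **Sum**: the two NEAR sums are `≤ ε/3` each by `NearDiagonalVanishing (ε/3)`, and `ε′a_k^{4n}·Σ_{box(L_k)ⁿ}‖F(a_k·)‖ ≤ ε′·C_F`
   by the `a`-uniform Riemann bound `pow_mul_sum_norm_le` (`Theorems/RecentredCoverTransferMeanShiftTwoPoint`, `a_k ≤ 1/24` from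
   `IsLegScheme`); with `ε′ = ε/(3(C_F+1))` the difference is `< ε` eventually.

Width seat ym-line-sfw-p2-w3 g28 (cell ym-idea-1; free hands).  THEOREMS ONLY.  HONEST FRAMING: `ProductBoundaryLaw` (23255, XL-IR: n-point
DLR-forgetfulness at physical depth) and `NearDiagonalVanishing` (23257, L given the cover ceilings) are OPEN; this glue proves no crux, no
rung (R2d ROT is a RECORD rung) and no summit; the Yang–Mills mass gap is NOT proved by any of this.
-/

set_option autoImplicit false

noncomputable section

open scoped SchwartzMap BigOperators ENNReal Classical
open MeasureTheory Filter Topology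
open Literature.MathematicalPhysics.QuantumFieldTheory Literature.MathematicalPhysics.QuantumLattice
open Literature.MathematicalPhysics.AQFT
open Literature.Probability.LatticeModels (Site box mem_box)
open Summit.QuantumFields.YangMills.Theorems.ROT (PeriodCell)
open Summit.QuantumFields.YangMills.Theorems.OSLegsFromFemtoAndGap (torusMoment latticeDist latticeDist_apply
  mul_norm_le_norm_smul_siteToE)

namespace Summit.QuantumFields.YangMills.Theorems.RecentredCoverTransfer

/-! ## §1 Elementary lemmas -/

/-- A lattice site outside `box L` is carried by the spacing `a` beyond radius `R` once `R < a (L + 1)`. [folklore] -/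
theorem lt_norm_smul_siteToE_of_not_mem_box {a R : ℝ} (ha : 0 < a) {L : ℕ} (hL : R < a * ((L : ℝ) + 1)) {z : Site 4}
    (hz : z ∉ box 4 L) : R < ‖a • siteToE z‖ := by
  rw [mem_box, not_forall] at hz
  obtain ⟨j, hj⟩ := hz
  have hjz : (L : ℤ) + 1 ≤ |z j| := by
    rw [not_and_or, not_le, not_le] at hj
    rcases hj with h | h
    · rw [abs_of_neg (by omega)]; omega
    · rw [abs_of_pos (by omega)]; omega
  have hzr : (L : ℝ) + 1 ≤ |((z j : ℤ) : ℝ)| := by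
    have h' : (((L : ℤ) + 1 : ℤ) : ℝ) ≤ ((|z j| : ℤ) : ℝ) := by exact_mod_cast hjz
    simpa [Int.cast_abs] using h'
  calc R < a * ((L : ℝ) + 1) := hL
    _ ≤ a * |((z j : ℤ) : ℝ)| := mul_le_mul_of_nonneg_left hzr ha.le
    _ ≤ a * ‖z‖ := by
        refine mul_le_mul_of_nonneg_left ?_ ha.le
        have h := norm_le_pi_norm z j
        rwa [Int.norm_eq_abs] at h
    _ ≤ ‖a • siteToE z‖ := mul_norm_le_norm_smul_siteToE ha.le z

/-- A function supported in the closed ball of radius `R` (sup norm on `(ℝ⁴)ⁿ`) vanishes at a tuple one of whose points has norm `> R`.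
[folklore] -/
theorem apply_eq_zero_of_lt_norm_apply {n : ℕ} {F : 𝓢((Fin n → EuclideanSpace ℝ (Fin 4)), ℂ)} {R : ℝ}
    (hR : tsupport (F : (Fin n → EuclideanSpace ℝ (Fin 4)) → ℂ) ⊆ Metric.closedBall 0 R)
    {u : Fin n → EuclideanSpace ℝ (Fin 4)} {i : Fin n} (hi : R < ‖u i‖) : F u = 0 := by
  refine image_eq_zero_of_notMem_tsupport fun hmem => ?_
  have h := hR hmem
  rw [mem_closedBall_zero_iff] at h
  linarith [norm_le_pi_norm u i]

/-- **Pointwise NEAR/FAR split.**  For reals `u, v`, a weight `f ≥ 0`, a tolerance `e ≥ 0` and a predicate `P` («near»): if in the far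
case either `|u − v| ≤ e` or `f = 0`, then `|u − v|·f ≤ 1_P·|u|·f + 1_P·|v|·f + e·f`. [folklore] -/
theorem abs_sub_mul_le_near_add_far {u v f e : ℝ} {P : Prop} [Decidable P] (hf : 0 ≤ f) (he : 0 ≤ e)
    (hfar : ¬P → |u - v| ≤ e ∨ f = 0) :
    |u - v| * f ≤ (if P then |u| * f else 0) + (if P then |v| * f else 0) + e * f := by
  by_cases hP : P
  · simp only [hP, if_true]
    have h1 : |u - v| ≤ |u| + |v| := abs_sub u v
    nlinarith
  · simp only [hP, if_false, zero_add]
    rcases hfar hP with h | h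
    · exact mul_le_mul_of_nonneg_right h hf
    · rw [h, mul_zero, mul_zero]

/-- `‖Σₓ (uₓ − vₓ)·Fₓ‖ ≤ Σₓ |uₓ − vₓ|·‖Fₓ‖` for real weights and complex values. [folklore] -/
theorem norm_sum_sub_mul_le {ι : Type*} (s : Finset ι) (u v : ι → ℝ) (F : ι → ℂ) :
    ‖∑ x ∈ s, ((u x : ℝ) : ℂ) * F x - ∑ x ∈ s, ((v x : ℝ) : ℂ) * F x‖ ≤ ∑ x ∈ s, |u x - v x| * ‖F x‖ := by
  rw [← Finset.sum_sub_distrib]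
  refine (norm_sum_le _ _).trans (Finset.sum_le_sum fun x _ => ?_)
  rw [← sub_mul, ← Complex.ofReal_sub, norm_mul, Complex.norm_real, Real.norm_eq_abs]

/-! ## §2 The glue -/

/-- **LINE g9-B′ glue**: the product boundary law (through the pointwise moment transfer) and near-diagonal vanishing give the
commonly-centred cover-to-torus transfer. [folklore] -/
theorem commonCentredCoverTransfer_of_productLaw
    (hPBL : Summit.QuantumFields.YangMills.Theses.RecentredCoverTransfer.ProductBoundaryLaw)
    (hPT : Summit.QuantumFields.YangMills.Theses.RecentredCoverTransfer.PointwiseTransferOfProductLaw)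
    (hND : Summit.QuantumFields.YangMills.Theses.RecentredCoverTransfer.NearDiagonalVanishing) :
    Summit.QuantumFields.YangMills.Theses.RecentredCoverTransfer.CommonCentredCoverTransfer := by
  intro G _ _ _ _ hG
  letI : MeasurableSpace G := borel G
  haveI : BorelSpace G := ⟨rfl⟩
  intro r a ha ha0 hMB sch hsch C hC n hn F hF hFc
  have PMT := hPT hPBL G hG r a ha ha0 hMB sch hsch C hC
  have ND := hND G hG r a ha ha0 hMB sch hsch C hC n hn F hF hFc
  obtain ⟨-, -, hk⟩ := hsch
  -- the support radius of `F` (sup norm on `(ℝ⁴)ⁿ`)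
  obtain ⟨KF, hKF⟩ := (Metric.isBounded_iff_subset_closedBall (0 : Fin n → EuclideanSpace ℝ (Fin 4))).1
    hFc.isCompact.isBounded
  -- the `a`-uniform Riemann bound constant of `F`
  obtain ⟨CF, hCF0, hCF⟩ : ∃ CF : ℝ, 0 ≤ CF ∧ ∀ (a' : ℝ), 0 < a' → a' ≤ 1 → ∀ s : Finset (Site 4),
      a' ^ (4 * n) * ∑ x ∈ Fintype.piFinset (fun _ : Fin n => s), ‖F (fun i => a' • siteToE (x i))‖ ≤ CF := by
    refine ⟨_, ?_, fun a' ha' ha1 s => pow_mul_sum_norm_le F ha' ha1 s⟩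
    exact mul_nonneg (mul_nonneg (by positivity) (apply_nonneg _ _)) (by positivity)
  -- representatives outside the box carry `F = 0`, eventually
  have hEsupp : ∀ᶠ k in atTop, ∀ x : Fin n → Site 4, (∃ i, x i ∉ box 4 (sch.L k)) →
      F (fun i => sch.a k • siteToE (x i)) = 0 := by
    have h1 : Tendsto (fun k => sch.a k * sch.L k + sch.a k) atTop atTop := sch.tendsto_L.atTop_add sch.tendsto_a
    filter_upwards [h1.eventually_gt_atTop KF] with k hk' x hx
    obtain ⟨i, hi⟩ := hx
    exact apply_eq_zero_of_lt_norm_apply hKF (i := i)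
      (lt_norm_smul_siteToE_of_not_mem_box (sch.a_pos k) (by linarith) hi)
  rw [Metric.tendsto_nhds]
  intro ε hε
  obtain ⟨δ, hδ, hNDev⟩ := ND (ε / 3) (by positivity)
  have hε' : 0 < ε / (3 * (CF + 1)) := by positivity
  have hPMTev := PMT n KF δ (ε / (3 * (CF + 1))) hδ hε'
  filter_upwards [hNDev, hPMTev, hEsupp] with k hNDk hPMTk hsuppk
  obtain ⟨hNC, hNT⟩ := hNDk
  obtain ⟨-, hk24, -, -⟩ := hk k
  have hk1 : sch.a k ≤ 1 := hk24.trans (by norm_num)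
  have hak := sch.a_pos k
  rw [dist_zero_right, PeriodCell.dist_apply, latticeDist_apply]
  -- the sum over `repsⁿ` is the sum over `box(L_k)ⁿ`
  have hsub : Fintype.piFinset (fun _ : Fin n => box 4 (sch.L k)) ⊆ Fintype.piFinset (fun _ : Fin n => (C k).reps) :=
    Fintype.piFinset_subset _ _ fun _ => (hC k).2
  rw [← Finset.sum_subset hsub (fun x _ hx => by
    rw [hsuppk x (by simpa [Fintype.mem_piFinset] using hx), mul_zero])]
  -- pointwise NEAR/FAR split, then sum
  refine lt_of_le_of_lt (norm_sum_sub_mul_le _ _ _ _) ?_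
  have hpt : ∀ x ∈ Fintype.piFinset (fun _ : Fin n => box 4 (sch.L k)),
      |(C k).moment r.ρ (sch.β k) r.curvature.F (wilsonTorusMean r.ρ (sch.β k) (sch.L k) r.curvature.F) x -
          torusMoment r.ρ (sch.β k) (sch.L k) r.curvature.F (wilsonTorusMean r.ρ (sch.β k) (sch.L k) r.curvature.F) x| *
        ‖F (fun i => sch.a k • siteToE (x i))‖ ≤
      (if (∃ i j : Fin n, i ≠ j ∧ ∀ l : Fin 4, sch.a k * |((x i l - x j l : ℤ) : ℝ)| < δ) then
          |(∫ U, ∏ i, (r.curvature.F (configShift (-(x i)) ((C k).lift U)) -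
              wilsonTorusMean r.ρ (sch.β k) (sch.L k) r.curvature.F) ∂((C k).measure r.ρ (sch.β k)))| *
            ‖F (fun i => (sch.a k) • siteToE (x i))‖ else 0) +
      (if (∃ i j : Fin n, i ≠ j ∧ ∀ l : Fin 4, sch.a k * |((x i l - x j l : ℤ) : ℝ)| < δ) then
          |(∫ U, ∏ i, (r.curvature.F (configShift (-(x i)) (torusLift (2 * sch.L k + 1) U)) -
              wilsonTorusMean r.ρ (sch.β k) (sch.L k) r.curvature.F)
              ∂(wilsonMeasure (d := 4) (L := 2 * sch.L k + 1) r.ρ (sch.β k)))| *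
            ‖F (fun i => (sch.a k) • siteToE (x i))‖ else 0) +
      ε / (3 * (CF + 1)) * (sch.a k) ^ (4 * n) * ‖F (fun i => sch.a k • siteToE (x i))‖ := by
    intro x hx
    refine abs_sub_mul_le_near_add_far (norm_nonneg _) (by positivity) fun hfar => ?_
    by_cases hK : ∀ i, ‖sch.a k • siteToE (x i)‖ ≤ KF
    · left
      refine hPMTk x (Fintype.mem_piFinset.1 hx) hK fun i j hij => ?_
      by_contra hcon
      push Not at hcon
      exact hfar ⟨i, j, hij, hcon⟩
    · right
      push Not at hK
      obtain ⟨i, hi⟩ := hK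
      have h0 : F (fun i => sch.a k • siteToE (x i)) = 0 :=
        apply_eq_zero_of_lt_norm_apply hKF (u := fun i => sch.a k • siteToE (x i)) (i := i) hi
      rw [h0, norm_zero]
  refine lt_of_le_of_lt (Finset.sum_le_sum hpt) ?_
  rw [Finset.sum_add_distrib, Finset.sum_add_distrib, ← Finset.mul_sum]
  have hfar : ε / (3 * (CF + 1)) * (sch.a k) ^ (4 * n) *
      ∑ x ∈ Fintype.piFinset (fun _ : Fin n => box 4 (sch.L k)), ‖F (fun i => sch.a k • siteToE (x i))‖ ≤
      ε / (3 * (CF + 1)) * CF := by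
    rw [mul_assoc]
    exact mul_le_mul_of_nonneg_left (hCF (sch.a k) hak hk1 _) hε'.le
  have hlast : ε / (3 * (CF + 1)) * CF < ε / 3 := by
    have h1 : ε / (3 * (CF + 1)) * CF < ε / (3 * (CF + 1)) * (CF + 1) := mul_lt_mul_of_pos_left (lt_add_one CF) hε'
    have h2 : ε / (3 * (CF + 1)) * (CF + 1) = ε / 3 := by
      field_simp
    linarith
  linarith

/-- **Item stmt-QuantumFields-23258 `RecentredCoverTransfer.CommonCentredOfProductLaw` holds**:
`ProductBoundaryLaw → PointwiseTransferOfProductLaw → NearDiagonalVanishing → CommonCentredCoverTransfer`. [folklore] -/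
theorem commonCentredOfProductLaw_proof :
    Summit.QuantumFields.YangMills.Theses.RecentredCoverTransfer.CommonCentredOfProductLaw :=
  fun hPBL hPT hND => commonCentredCoverTransfer_of_productLaw hPBL hPT hND

end Summit.QuantumFields.YangMills.Theorems.RecentredCoverTransfer

end

/-! ## Registration under the «product-law» skeleton of crux `CommonCentredCoverTransfer` (stmt-QuantumFields-23106)

The registered skeleton `Cruxes/CommonCentredCoverTransfer` («product-law», planner ym-idea-1 g9, LINE g9-B′) names this item as its
stub 4, `Summit.QuantumFields.YangMills.Cruxes.CommonCentredCoverTransfer.ProductLaw.stub_commonCentredOfProductLaw`; recorded here BY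
NAME (appended 2026-08-28; previous declarations byte-identical). -/

namespace Summit.QuantumFields.YangMills.Cruxes.CommonCentredCoverTransfer.ProductLaw

/-- **Stub 4 of «product-law» (crux stmt-QuantumFields-23106), BY NAME**: the glue
`ProductBoundaryLaw → PointwiseTransferOfProductLaw → NearDiagonalVanishing → CommonCentredCoverTransfer` (= item 23258). [folklore] -/
theorem stub_commonCentredOfProductLaw :
    Summit.QuantumFields.YangMills.Theses.RecentredCoverTransfer.CommonCentredOfProductLaw :=
  Summit.QuantumFields.YangMills.Theorems.RecentredCoverTransfer.commonCentredOfProductLaw_proof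

end Summit.QuantumFields.YangMills.Cruxes.CommonCentredCoverTransfer.ProductLaw
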